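/-
Copyright (c) 2026 the pub-hodgecm-mathlib formalisation cell (harness21).  Prover seat hodgecm-mathlib-LH4-p01 (g12): road M6 → F5 → dyadic chain of `stub_DyUnramCore` (D-UNR),
site (L2-3) «THE WALL», brick «C2 — CENTRE TRANSPORT» between rows 5 and 8 of CENSUS-L23-CM v1 (LH10-p01 (g12)); 2026-09-03.
-/
import Literature.NumberTheory.Automorphic.TypeTwoHermitianMoebiusShiftValued   -- ★ P2 p853646 (LH10-p01 (g12)): `eval_charpoly_genMoebius_fin_two`, `hermitianPair_key_scalar`; brings ★ α `trace_mul_inv_mul_det_fin_two`, `det_mul_inv_eq_div`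
import Literature.NumberTheory.Automorphic.MatrixMoebiusShiftHermitian        -- ★ P1 p853610 (LH10-p01 (g12)): `valued_det_and_inv_c_add` (`|det(c•1 + t•E)| = exp(−2)` for `E ≡ 0 (c²)`); brings ★ N5a `valued_pow_of_valued_eq_exp_neg_one`
import HarnessLib

/-!
# The ADMISSIBLE EISENSTEIN CENTRE under the hermitian Cayley shift: `(a, f, e′, j) ↦ (ψ_θ(a), f₁, e₁′, j − 1)` — type (2), `2 × 2`, any residue characteristic
# (Kottwitz 1986 §3; Rogawski 1990 §4.9; Serre, Local Fields I §6)

Topic `NumberTheory/Automorphic`; namespace `Literature.NumberTheory.Automorphic.MoebiusShift`.  THEOREMS ONLY (no definition, no instance, no notation, no named fact, no `sorry`);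
generic `[Field K] [Valued K ℤᵐ⁰]`; kernel lane `--supports stmt-HodgeConjecture-24833`.  Cell `pub/hodgecm-mathlib` (D-0151), crux H413 = `stmt-HodgeConjecture-24833`; road M6 →
F5 → the dyadic chain of organ (D-UNR) `stub_DyUnramCore`, LEVEL TWO, site (L2-3) «THE WALL» = ★ `liftInterior_of_levelTwo` with `h2` deleted.

WHY.  At `v ∤ 2` the depth of a type-(2) element `g` (irreducible characteristic polynomial) is read off the DISCRIMINANT, `|tr² − 4det|_w = exp(−(2N+1))`, and ★
`shifted_binders_of_typeTwo` moves it `N ↦ N − 1` under the Cayley shift.  At `v ∣ 2` the discriminant exponent is `d + 2N` with `d` the different exponent of the wild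
quadratic extension `L_w(λ)∕L_w` — of EITHER parity — so the H-side heads of the 2-free road read the depth off an ADMISSIBLE EISENSTEIN CENTRE instead (★ Chi-aff
`…_of_not_exists_isRoot_affine`, ★ ROW 8 `stableOrbitalIntegralRel_chi_shift_of_not_exists_isRoot_affine`): `(a, f, e′, j)` with `|a| ≤ 1`, `tr g − 2a = f`, `|f| ≤ |c|^{j+1}`,
`χ_g(a) = a² − tr g·a + det g = −e′`, `|e′| = |c|^{2j+1}` (`c` the uniformiser).  THIS FILE transports the centre along the hermitian shift
`g₁ = φ_θ(g) = (θ•g + (c−θ)•1)((c−θ′)•g + θ′•1)⁻¹`, `θ + θ′ = 1` (LH10-p01 MEMO-L23-θSHIFT): with `ψ(a) = (θa + (c−θ))∕((c−θ′)a + θ′)`, `Δ = θθ′ − (c−θ)(c−θ′) = c(1−c)`,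
`D(a) = (c−θ′)a + θ′`, `D_g = (c−θ′)g + θ′•1`,
  `χ_{g₁}(ψ a)·D(a)²·det D_g = Δ²·χ_g(a)`   (★ P2 `eval_charpoly_genMoebius_fin_two`),
  `(tr g₁ − 2ψ a)·det D_g·D(a) = Δ·(D(a)·(tr g − 2a) + 2(c−θ′)·χ_g(a))`   (§1, a polynomial identity),
and for a 2-DEEP `g` (`g ≡ 1 (mod c²)` entrywise): `|Δ| = |D(a)| = |c|`, `|det D_g| = |c|²`, hence `|e₁′| = |e′|∕|c|² = |c|^{2(j−1)+1}` and
`|f₁| ≤ max(|f|∕|c|, |2|·|e′|∕|c|²) ≤ |c|^{(j−1)+1}` (the `2` enters only through `|2| ≤ 1`) — `(ψ a, f₁, e₁′, j − 1)` is an admissible centre of `g₁`.  This is the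
type-(2) depth bookkeeping of the 2-free organ (I): with ★ (P2d-α) `exists_eisensteinData_at_place` + ★ `exists_admissibleCentre_of_eisensteinBlock` (centre of `γ_H`, `j = N`)
it feeds ★ ROW 8 at `(j, j − 1)`.  Count-neutral; nothing printed is asserted here.
HONEST LABEL: HC_CM is proved only modulo the 7 printed citations (2 remaining: hLiu418 = stmt-HodgeConjecture-24832, h413 = stmt-HodgeConjecture-24833) until rung 0 closes.

* §1 `trace_genMoebius_sub_two_mul_mul_eq` (the polynomial identity, four scalars), `valued_one_sub_centre_lt` (`|1 − a| < |c|` for a centre of a 2-deep `g`);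
* §2 **`exists_admissibleCentre_hermitianMoebius`** (THE TRANSPORT).

## References
* [Kottwitz1986BaseChangeUnits] R. E. Kottwitz, *Base change for unit elements of Hecke algebras*, Compositio Math. 60 (1986): §1 pp. 240–241, §3.
* [Rogawski1990] J. D. Rogawski, *Automorphic Representations of Unitary Groups in Three Variables*, Ann. of Math. Stud. 123 (1990): §4.9 Prop. 4.9.1 (b) p. 55, Lemma 4.9.3 p. 56.
* [SerreLocalFields1979] J.-P. Serre, *Local Fields*, GTM 67 (1979): Ch. I §6 (Eisenstein equations).
* [HornJohnson2013] R. A. Horn, C. R. Johnson, *Matrix Analysis*, 2nd ed. (2013): §0.8.2, §1.2.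
-/

set_option autoImplicit false

noncomputable section

open Matrix Polynomial
open scoped WithZero

namespace Literature.NumberTheory.Automorphic.MoebiusShift

/-! ## §1 The trace identity of the general shift at a centre, and `|1 − a| < |c|` -/

section FinTwo

variable {K : Type*} [Field K]

/-- **The trace of the general shift against the shifted centre**: for `N = A•g + B•1`, `D = B′•g + A′•1` (`det D ≠ 0`), `D(a) = B′a + A′ ≠ 0`, `ψ(a) = (Aa + B)∕D(a)`:
`(tr(N D⁻¹) − 2ψ(a))·det D·D(a) = (AA′ − BB′)·(D(a)·(tr g − 2a) + 2B′·(a² − tr g·a + det g))` (`2 × 2`; a polynomial identity, via ★ α `trace_mul_inv_mul_det_fin_two`).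
[cite: HornJohnson2013, §0.8.2] [cite: Kottwitz1986BaseChangeUnits, §3] -/
theorem trace_genMoebius_sub_two_mul_mul_eq (g : Matrix (Fin 2) (Fin 2) K) (A B A' B' a : K) (hD : (B' • g + A' • (1 : Matrix (Fin 2) (Fin 2) K)).det ≠ 0)
    (hDa : B' * a + A' ≠ 0) :
    (((A • g + B • (1 : Matrix (Fin 2) (Fin 2) K)) * (B' • g + A' • (1 : Matrix (Fin 2) (Fin 2) K))⁻¹).trace - 2 * ((A * a + B) / (B' * a + A'))) *
        (B' • g + A' • (1 : Matrix (Fin 2) (Fin 2) K)).det * (B' * a + A') =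
      (A * A' - B * B') * ((B' * a + A') * (g.trace - 2 * a) + 2 * B' * (a * a - g.trace * a + g.det)) := by
  set N : Matrix (Fin 2) (Fin 2) K := A • g + B • 1 with hN
  set D : Matrix (Fin 2) (Fin 2) K := B' • g + A' • 1 with hDdef
  have htr := trace_mul_inv_mul_det_fin_two N D hD
  have hψ : (A * a + B) / (B' * a + A') * (B' * a + A') = A * a + B := div_mul_cancel₀ _ hDa
  have e1 : ((N * D⁻¹).trace - 2 * ((A * a + B) / (B' * a + A'))) * D.det * (B' * a + A') =
      ((N * D⁻¹).trace * D.det) * (B' * a + A') - 2 * (A * a + B) * D.det := by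
    calc ((N * D⁻¹).trace - 2 * ((A * a + B) / (B' * a + A'))) * D.det * (B' * a + A')
        = ((N * D⁻¹).trace * D.det) * (B' * a + A') - 2 * ((A * a + B) / (B' * a + A') * (B' * a + A')) * D.det := by ring
      _ = ((N * D⁻¹).trace * D.det) * (B' * a + A') - 2 * (A * a + B) * D.det := by rw [hψ]
  rw [e1, htr]
  simp [hN, hDdef, Matrix.trace_fin_two, Matrix.det_fin_two, Matrix.mul_apply, Fin.sum_univ_two, Matrix.one_apply]
  ring

end FinTwo

section Valued

variable {K : Type*} [Field K] [Valued K ℤᵐ⁰]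

/-- **A centre of a 2-deep `g` is close to `1`: `|1 − a| < |c|`.**  From `tr g − 2a = f`, `χ_g(a) = −e′` one has `(1−a)·((1−a) − f) = χ_g(1) + e′`; for `g ≡ 1 (mod c²)`
entrywise `|χ_g(1)| = |det(g − 1)| ≤ |c|⁴`, and `|f| ≤ |c|²`, `|e′| ≤ |c|³` force `|1 − a| < |c|`. [cite: SerreLocalFields1979, Ch. I §6] [cite: Kottwitz1986BaseChangeUnits, §3] -/
theorem valued_one_sub_centre_lt {c : K} (hc : Valued.v c = WithZero.exp (-1 : ℤ)) (g : Matrix (Fin 2) (Fin 2) K)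
    (hg : ∀ i k, Valued.v ((g - 1) i k) ≤ Valued.v c ^ 2) {a f e' : K}
    (hf : Valued.v f ≤ Valued.v c ^ 2) (he : Valued.v e' ≤ Valued.v c ^ 3)
    (htf : g.trace - 2 * a = f) (hde : a * a - g.trace * a + g.det = -e') :
    Valued.v (1 - a) < Valued.v c := by
  have hcpow := valued_pow_of_valued_eq_exp_neg_one hc
  -- `χ_g(1) = det(g − 1)`, of valuation `≤ |c|⁴`
  have hchi1 : (1 : K) - g.trace + g.det = (g - 1).det := by
    simp [Matrix.det_fin_two, Matrix.trace_fin_two, Matrix.sub_apply]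
    ring
  have hdet4 : Valued.v ((g - 1).det) ≤ Valued.v c ^ 4 := by
    rw [Matrix.det_fin_two, show (4 : ℕ) = 2 + 2 by norm_num, pow_add]
    refine (Valuation.map_sub _ _ _).trans (max_le ?_ ?_)
    · rw [map_mul]; exact mul_le_mul' (hg 0 0) (hg 1 1)
    · rw [map_mul]; exact mul_le_mul' (hg 0 1) (hg 1 0)
  -- `(1−a)((1−a) − f) = χ_g(1) + e′`
  have key : (1 - a) * ((1 - a) - f) = ((1 : K) - g.trace + g.det) + e' := by
    rw [← htf]; linear_combination -hde
  have hrhs : Valued.v (((1 : K) - g.trace + g.det) + e') ≤ Valued.v c ^ 3 := by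
    refine (Valuation.map_add _ _ _).trans (max_le ?_ he)
    rw [hchi1]
    refine hdet4.trans ?_
    rw [hcpow, hcpow]; exact WithZero.exp_le_exp.2 (by norm_num)
  by_contra hlt
  have hge : Valued.v c ≤ Valued.v (1 - a) := not_lt.1 hlt
  have hc1 : Valued.v c < 1 := by rw [hc, ← WithZero.exp_zero]; exact WithZero.exp_lt_exp.2 (by norm_num)
  have hc0' : 0 < Valued.v c := by rw [hc]; exact WithZero.exp_pos
  have hfy : Valued.v f < Valued.v (1 - a) := by
    refine lt_of_le_of_lt hf (lt_of_lt_of_le ?_ hge)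
    calc Valued.v c ^ 2 = Valued.v c * Valued.v c := sq _
      _ < Valued.v c * 1 := mul_lt_mul_of_pos_left hc1 hc0'
      _ = Valued.v c := mul_one _
  have hyf : Valued.v ((1 - a) - f) = Valued.v (1 - a) := Valuation.map_sub_eq_of_lt_left _ hfy
  have hprod : Valued.v ((1 - a) * ((1 - a) - f)) = Valued.v (1 - a) * Valued.v (1 - a) := by rw [map_mul, hyf]
  have hle : Valued.v (1 - a) * Valued.v (1 - a) ≤ Valued.v c ^ 3 := by rw [← hprod, key]; exact hrhs
  have hge2 : Valued.v c ^ 2 ≤ Valued.v (1 - a) * Valued.v (1 - a) := by rw [sq]; exact mul_le_mul' hge hge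
  have h23 : Valued.v c ^ 3 < Valued.v c ^ 2 := by rw [hcpow, hcpow]; exact WithZero.exp_lt_exp.2 (by norm_num)
  exact absurd (hge2.trans hle) (not_le.2 h23)

/-! ## §2 THE TRANSPORT of an admissible centre along `φ_θ` -/

/-- **CENTRE TRANSPORT «C2» (any residue characteristic).**  `θ + θ′ = 1`, `|θ|, |θ′| ≤ 1`, `|c| = exp(−1)`; `g` `2 × 2` with `g ≡ 1 (mod c²)` entrywise;
`(a, f, e′, j)` an ADMISSIBLE CENTRE of `g` (`tr g − 2a = f`, `|f| ≤ |c|^{j+1}`, `a² − tr g·a + det g = −e′`, `|e′| = |c|^{2j+1}`, `1 ≤ j`).  Then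
`g₁ = (θ•g + (c−θ)•1)((c−θ′)•g + θ′•1)⁻¹` has the admissible centre `(a₁, f₁, e₁′, j−1)` with `a₁ = ψ(a) = (θa + (c−θ))∕((c−θ′)a + θ′)`: `|a₁| ≤ 1`, `tr g₁ − 2a₁ = f₁`,
`|f₁| ≤ |c|^{(j−1)+1}`, `a₁² − tr g₁·a₁ + det g₁ = −e₁′`, `|e₁′| = |c|^{2(j−1)+1}` (§ module docstring for the identities and the valuation count; the `2` of `f₁`'s formula enters
only through `|2| ≤ 1`; `|a| ≤ 1` is not even needed: `|1 − a| < |c|` follows from 2-deepness).  This is the 2-free replacement of ★ `shifted_binders_of_typeTwo`'s `hN ↦ hN′` (odd discriminant exponent, false at `v ∣ 2` for wild tori of even different).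
[cite: Kottwitz1986BaseChangeUnits, §3] [cite: Rogawski1990, §4.9 Prop. 4.9.1 (b) p. 55, Lemma 4.9.3 p. 56] [cite: SerreLocalFields1979, Ch. I §6] -/
theorem exists_admissibleCentre_hermitianMoebius {θ θ' c : K} (hθθ' : θ + θ' = 1) (hθv : Valued.v θ ≤ 1) (hθ'v : Valued.v θ' ≤ 1)
    (hc : Valued.v c = WithZero.exp (-1 : ℤ)) (g : Matrix (Fin 2) (Fin 2) K) (hg : ∀ i k, Valued.v ((g - 1) i k) ≤ Valued.v c ^ 2)
    {a f e' : K} {j : ℕ} (hj : 1 ≤ j)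
    (hf : Valued.v f ≤ Valued.v c ^ (j + 1)) (he : Valued.v e' = Valued.v c ^ (2 * j + 1))
    (htf : g.trace - 2 * a = f) (hde : a * a - g.trace * a + g.det = -e') :
    ∃ a₁ f₁ e₁' : K, a₁ = (θ * a + (c - θ)) / ((c - θ') * a + θ') ∧ Valued.v a₁ ≤ 1 ∧
      ((θ • g + (c - θ) • (1 : Matrix (Fin 2) (Fin 2) K)) * ((c - θ') • g + θ' • (1 : Matrix (Fin 2) (Fin 2) K))⁻¹).trace - 2 * a₁ = f₁ ∧
      Valued.v f₁ ≤ Valued.v c ^ (j - 1 + 1) ∧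
      a₁ * a₁ - ((θ • g + (c - θ) • (1 : Matrix (Fin 2) (Fin 2) K)) * ((c - θ') • g + θ' • (1 : Matrix (Fin 2) (Fin 2) K))⁻¹).trace * a₁ +
          ((θ • g + (c - θ) • (1 : Matrix (Fin 2) (Fin 2) K)) * ((c - θ') • g + θ' • (1 : Matrix (Fin 2) (Fin 2) K))⁻¹).det = -e₁' ∧
      Valued.v e₁' = Valued.v c ^ (2 * (j - 1) + 1) := by
  obtain ⟨m, rfl⟩ : ∃ m, j = m + 1 := ⟨j - 1, by omega⟩
  simp only [Nat.add_sub_cancel]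
  have hcpow := valued_pow_of_valued_eq_exp_neg_one hc
  have hc0 : c ≠ 0 := fun h => by rw [h, map_zero] at hc; exact WithZero.zero_ne_coe hc
  have hc1 : Valued.v c < 1 := by rw [hc, ← WithZero.exp_zero]; exact WithZero.exp_lt_exp.2 (by norm_num)
  have hcpos : 0 < Valued.v c := by rw [hc]; exact WithZero.exp_pos
  have h1c : Valued.v (1 - c) = 1 := by
    rw [Valuation.map_sub_eq_of_lt_left _ (show Valued.v c < Valued.v (1 : K) by rw [map_one]; exact hc1), map_one]
  -- the key scalar `Δ = c(1 − c)`, `|Δ| = |c|`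
  have hΔeq : θ * θ' - (c - θ) * (c - θ') = c * (1 - c) := by
    have hθ' : θ' = 1 - θ := by linear_combination hθθ'
    rw [hθ']; ring
  have hΔv : Valued.v (θ * θ' - (c - θ) * (c - θ')) = Valued.v c := by rw [hΔeq, map_mul, h1c, mul_one]
  have hΔ0 : θ * θ' - (c - θ) * (c - θ') ≠ 0 := fun h => by rw [h, map_zero] at hΔv; exact (Valuation.ne_zero_iff _).2 hc0 hΔv.symm
  -- `|1 − a| < |c|`, so `|D(a)| = |N(a)| = |c|`
  have hf2 : Valued.v f ≤ Valued.v c ^ 2 := hf.trans (pow_le_pow_right_of_le_one' hc1.le (by omega))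
  have he3 : Valued.v e' ≤ Valued.v c ^ 3 := by rw [he]; exact pow_le_pow_right_of_le_one' hc1.le (by omega)
  have hya := valued_one_sub_centre_lt hc g hg hf2 he3 htf hde
  have htθ' : Valued.v (c - θ') ≤ 1 := (Valuation.map_sub _ _ _).trans (max_le hc1.le hθ'v)
  have hDa_eq : (c - θ') * a + θ' = c + -((c - θ') * (1 - a)) := by ring
  have hNa_eq : θ * a + (c - θ) = c + -(θ * (1 - a)) := by ring
  have hsmallD : Valued.v (-((c - θ') * (1 - a))) < Valued.v c := by
    rw [Valuation.map_neg, map_mul]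
    calc Valued.v (c - θ') * Valued.v (1 - a) ≤ 1 * Valued.v (1 - a) := mul_le_mul' htθ' le_rfl
      _ < Valued.v c := by rw [one_mul]; exact hya
  have hsmallN : Valued.v (-(θ * (1 - a))) < Valued.v c := by
    rw [Valuation.map_neg, map_mul]
    calc Valued.v θ * Valued.v (1 - a) ≤ 1 * Valued.v (1 - a) := mul_le_mul' hθv le_rfl
      _ < Valued.v c := by rw [one_mul]; exact hya
  have hDav : Valued.v ((c - θ') * a + θ') = Valued.v c := by rw [hDa_eq, Valuation.map_add_eq_of_lt_left _ hsmallD]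
  have hNav : Valued.v (θ * a + (c - θ)) = Valued.v c := by rw [hNa_eq, Valuation.map_add_eq_of_lt_left _ hsmallN]
  have hDa0 : (c - θ') * a + θ' ≠ 0 := fun h => by rw [h, map_zero] at hDav; exact (Valuation.ne_zero_iff _).2 hc0 hDav.symm
  -- `|det D_g| = exp(−2)`: `D_g = c•1 + (c−θ′)•(g − 1)`
  set E : Matrix (Fin 2) (Fin 2) K := g - 1 with hE
  have hDg_eq : (c - θ') • g + θ' • (1 : Matrix (Fin 2) (Fin 2) K) = c • (1 : Matrix (Fin 2) (Fin 2) K) + (c - θ') • E := by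
    rw [hE, smul_sub]
    module
  obtain ⟨hdetD, -⟩ := valued_det_and_inv_c_add hc htθ' (le_refl 1) (j := 1) (fun i k => by rw [show (1 : ℕ) + 1 = 2 by rfl]; exact hg i k)
  have hdetDv : Valued.v ((c - θ') • g + θ' • (1 : Matrix (Fin 2) (Fin 2) K)).det = Valued.v c ^ 2 := by rw [hDg_eq, hdetD, hcpow]; norm_num
  have hD0 : ((c - θ') • g + θ' • (1 : Matrix (Fin 2) (Fin 2) K)).det ≠ 0 := fun h => by
    rw [h, map_zero] at hdetDv; exact pow_ne_zero 2 ((Valuation.ne_zero_iff _).2 hc0) hdetDv.symm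
  -- names
  set g₁ : Matrix (Fin 2) (Fin 2) K := (θ • g + (c - θ) • (1 : Matrix (Fin 2) (Fin 2) K)) * ((c - θ') • g + θ' • (1 : Matrix (Fin 2) (Fin 2) K))⁻¹ with hg₁
  set a₁ : K := (θ * a + (c - θ)) / ((c - θ') * a + θ') with ha₁
  refine ⟨a₁, g₁.trace - 2 * a₁, -(a₁ * a₁ - g₁.trace * a₁ + g₁.det), rfl, ?_, rfl, ?_, by ring, ?_⟩
  · -- `|a₁| = |c|∕|c| ≤ 1`
    rw [ha₁, map_div₀, hNav, hDav, div_self ((Valuation.ne_zero_iff _).2 hc0)]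
  · -- `|f₁| ≤ |c|^{m+1}`: the trace identity, read in `exp` currency
    have hid := trace_genMoebius_sub_two_mul_mul_eq g θ (c - θ) θ' (c - θ') a hD0 hDa0
    rw [← hg₁, ← ha₁] at hid
    have h2 : Valued.v (2 : K) ≤ 1 := by
      have : (2 : K) = 1 + 1 := by norm_num
      rw [this]; exact (Valuation.map_add _ _ _).trans (max_le (by rw [map_one]) (by rw [map_one]))
    -- valuation of the right-hand side: `≤ exp(−(m+4))`
    have hR : Valued.v ((θ * θ' - (c - θ) * (c - θ')) * (((c - θ') * a + θ') * (g.trace - 2 * a) + 2 * (c - θ') * (a * a - g.trace * a + g.det))) ≤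
        WithZero.exp (-((m : ℤ) + 4)) := by
      rw [map_mul, hΔv, hc, htf, hde, show (-((m : ℤ) + 4)) = (-1 : ℤ) + (-((m : ℤ) + 3)) by ring, WithZero.exp_add]
      refine mul_le_mul' le_rfl ((Valuation.map_add _ _ _).trans (max_le ?_ ?_))
      · rw [map_mul, hDav, hc]
        calc WithZero.exp (-1 : ℤ) * Valued.v f ≤ WithZero.exp (-1 : ℤ) * Valued.v c ^ (m + 1 + 1) := mul_le_mul' le_rfl hf
          _ = WithZero.exp (-((m : ℤ) + 3)) := by rw [hcpow, ← WithZero.exp_add]; congr 1; omega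
      · rw [map_mul, map_mul, Valuation.map_neg, he, hcpow]
        calc Valued.v 2 * Valued.v (c - θ') * WithZero.exp (-((2 * (m + 1) + 1 : ℕ) : ℤ)) ≤ 1 * 1 * WithZero.exp (-((2 * (m + 1) + 1 : ℕ) : ℤ)) :=
              mul_le_mul' (mul_le_mul' h2 htθ') le_rfl
          _ = WithZero.exp (-((2 * (m + 1) + 1 : ℕ) : ℤ)) := by rw [one_mul, one_mul]
          _ ≤ WithZero.exp (-((m : ℤ) + 3)) := WithZero.exp_le_exp.2 (by push_cast; omega)
    -- valuation of the left-hand side is `|f₁|·exp(−3)`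
    have hL : Valued.v ((g₁.trace - 2 * a₁) * ((c - θ') • g + θ' • (1 : Matrix (Fin 2) (Fin 2) K)).det * ((c - θ') * a + θ')) =
        Valued.v (g₁.trace - 2 * a₁) * WithZero.exp (-3 : ℤ) := by
      rw [map_mul, map_mul, hdetDv, hDav, hcpow, hc, mul_assoc, ← WithZero.exp_add, show (-((2 : ℕ) : ℤ) + -1 : ℤ) = -3 by norm_num]
    rw [hid] at hL
    rw [hL] at hR
    rw [hcpow]
    calc Valued.v (g₁.trace - 2 * a₁) = Valued.v (g₁.trace - 2 * a₁) * WithZero.exp (-3 : ℤ) * WithZero.exp (3 : ℤ) := by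
          rw [mul_assoc, ← WithZero.exp_add, show (-3 : ℤ) + 3 = 0 by norm_num, WithZero.exp_zero, mul_one]
      _ ≤ WithZero.exp (-((m : ℤ) + 4)) * WithZero.exp (3 : ℤ) := mul_le_mul' hR le_rfl
      _ = WithZero.exp (-((m + 1 : ℕ) : ℤ)) := by
          rw [← WithZero.exp_add, show (-((m : ℤ) + 4)) + 3 = -((m + 1 : ℕ) : ℤ) by push_cast; ring]
  · -- `|e₁′| = |c|^{2m+1}`: ★ P2 `eval_charpoly_genMoebius_fin_two` at `u = a`
    have hid := eval_charpoly_genMoebius_fin_two g θ (c - θ) θ' (c - θ') a hD0 hDa0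
    rw [← hg₁, ← ha₁, Matrix.charpoly_fin_two, Matrix.charpoly_fin_two] at hid
    simp only [eval_add, eval_sub, eval_mul, eval_pow, eval_C, eval_X] at hid
    have hid' : (a₁ * a₁ - g₁.trace * a₁ + g₁.det) * ((c - θ') * a + θ') ^ 2 * ((c - θ') • g + θ' • (1 : Matrix (Fin 2) (Fin 2) K)).det =
        (θ * θ' - (c - θ) * (c - θ')) ^ 2 * (a * a - g.trace * a + g.det) := by
      rw [show a₁ * a₁ = a₁ ^ 2 by ring, show a * a = a ^ 2 by ring]; exact hid
    have hv := congrArg Valued.v hid'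
    rw [map_mul, map_mul, map_pow, hDav, hdetDv, map_mul, map_pow, hΔv, hde, Valuation.map_neg, he] at hv
    -- `hv : |X|·|c|²·|c|² = |c|²·|c|^{2m+3}`
    rw [Valuation.map_neg]
    have hpos : (Valued.v c ^ 2 * Valued.v c ^ 2) ≠ 0 := (mul_pos (pow_pos hcpos 2) (pow_pos hcpos 2)).ne'
    have hX : Valued.v (a₁ * a₁ - g₁.trace * a₁ + g₁.det) * (Valued.v c ^ 2 * Valued.v c ^ 2) = Valued.v c ^ (2 * m + 1) * (Valued.v c ^ 2 * Valued.v c ^ 2) := by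
      calc Valued.v (a₁ * a₁ - g₁.trace * a₁ + g₁.det) * (Valued.v c ^ 2 * Valued.v c ^ 2)
          = Valued.v (a₁ * a₁ - g₁.trace * a₁ + g₁.det) * Valued.v c ^ 2 * Valued.v c ^ 2 := (mul_assoc _ _ _).symm
        _ = Valued.v c ^ 2 * Valued.v c ^ (2 * (m + 1) + 1) := hv
        _ = Valued.v c ^ (2 + (2 * (m + 1) + 1)) := (pow_add _ _ _).symm
        _ = Valued.v c ^ ((2 * m + 1) + (2 + 2)) := by congr 1; omega
        _ = Valued.v c ^ (2 * m + 1) * (Valued.v c ^ 2 * Valued.v c ^ 2) := by rw [pow_add _ (2 * m + 1) (2 + 2), pow_add _ 2 2]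
    exact mul_right_cancel₀ hpos hX

end Valued

end Literature.NumberTheory.Automorphic.MoebiusShift

end
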